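import Summits.BirchSwinnertonDyer.BirchSwinnertonDyer.Theorems.ClassRecordThreeIMCDivAtThreeLambdaMatchingCut
import Summits.BirchSwinnertonDyer.BirchSwinnertonDyer.Theorems.ClassRecordThreeCornerAtThreeCoChainDefs
import Literature.NumberTheory.EllipticCurves.MastellaZerman2026.HasPadicScalarImageOfIrreducibleProofs
import HarnessLib

/-!
# Crux idea `normaliser-image-feeds-howard-at-mult-3` — sketch (cell `bsd-stepL`, seat mult-idea g9)
# crux stmt-BirchSwinnertonDyer-21420 `ClassRecordThree.CornerAtThreeW`, conjunct (U) = `Three.CornerUpperAt`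
# through its Kolyvagin-system («⊇») twin `Three.CornerCoStepLAt`

Nothing here is a route item; no `sorry`. §1 is a KERNEL corollary (Mastella–Zerman's image certificate
`HasPadicScalarImage W 3` holds on the whole ¬Surj corner, by the tree's Lombardo–Tronto theorem); §2 types the
candidate `Prop`s of the idea card over existing declarations; §3 records the shape of the road to the crux
conjunct (implications as `Prop`s, not claimed).
-/

set_option linter.dupNamespace false

noncomputable section

open scoped Classical

open WeierstrassCurve NumberField IsDedekindDomain Field PowerSeries
  Literature.NumberTheory.EllipticCurves Literature.NumberTheory.EllipticCurves.ModularForms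
  Literature.NumberTheory.EllipticCurves.Rank1Residual
  Literature.NumberTheory.EllipticCurves.MastellaZerman2026
  Literature.NumberTheory.GaloisRepresentations
  Summit.BirchSwinnertonDyer.Rank1Residual Summit.BirchSwinnertonDyer.Rank1Residual.X11b
  Summit.BirchSwinnertonDyer.Rank1Residual.X11b.AcSelmer
  Summit.BirchSwinnertonDyer.Rank1Residual.X11b.Halves
  Summit.BirchSwinnertonDyer.Rank1Residual.X11b.Three

namespace Summit.BirchSwinnertonDyer.BirchSwinnertonDyer.Cruxes.CornerAtThreeW.NormaliserImageHoward

/-! ### §1. Kernel: Mastella–Zerman's Assumption 2.13 (v) holds on the WHOLE corner -/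

/-- **The corner satisfies Mastella–Zerman 2026's image hypothesis at `3`**: for `(E, 3) ∈` X11b with
`ρ̄_{E,3}` NOT surjective (hence irreducible with image `N(C_s) ≅ D₄` or `N(C_ns) ≅ SD₁₆`), the `3`-adic image
`ρ_{E,3^∞}(Γ_ℚ)` contains every scalar `a ≡ 1 (mod 3)` — Lombardo–Tronto 2022 Thm. 3.16 / Prop. 3.12 in the
tree's kernel form, whose binders (`p ≠ 2`, `Irr`, `¬ Surj`) are exactly the corner's. So the ONLY image input of
MZ26 Thm. 3.15 / Lemma 2.39 beyond irreducibility is a THEOREM on every corner curve (no per-curve certificate). -/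
theorem hasPadicScalarImage_of_corner (W : WeierstrassCurve ℚ) [W.IsElliptic]
    (hX : ClassX11b W 3) (hns : ¬ Surj W 3) : HasPadicScalarImage W 3 :=
  hasPadicScalarImage_of_hasIrreducibleModPGaloisRep_of_not_hasSurjectiveModNGaloisRep W 3
    (by decide) hX.2.2.2 hns

/-! ### §2. Typed candidate `Prop`s -/

/-- **(ii′) at the base — FIRST LEMMA of the line**: on the corner, `−1 ∈ ρ_{E,3^∞}(Γ_ℚ)` (a `σ ∈ Γ_ℚ` acting
as `−1` on `T₃E`). Mechanism: `−I ∈ N(C_s)`, `N(C_ns)` is the central involution of a faithful irreducible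
`2`-group image, so `−I = ρ̄(σ₀)`; then `ρ(σ₀^{3^k}) → −1` and compactness. This is use-site (ii) of Howard 2004a's
surjectivity (PROOF-BDP §48.1) at `F = ℚ`; over a Heegner `K` and up the anticyclotomic tower it propagates by
`K_∞ ∩ ℚ(E[3^∞]) = ℚ` (ramification + centrality, image-free). OPEN as a kernel item; elementary. -/
def CornerNegOneInThreeAdicImage : Prop :=
  ∀ (W : WeierstrassCurve ℚ) [W.IsElliptic], ClassX11b W 3 → ¬ Surj W 3 →
    ∃ σ : Field.absoluteGaloisGroup ℚ, galoisRepTate W 3 σ = -1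

/-- **UB₃ on the corner (the DECIDING typed candidate; twin of `stub_ub3_ratUpperDivisibility` of the surjective
class with `Surj W 3` replaced by `¬ Surj W 3` and the (ram) clause dropped — the corner has no (ram))**: the
RATIONAL Euler-system-side inclusion `∃ k, 3^k · L ∈ Ch_Λ(X_ac 𝔭bar ∅)·R₀⟦T⟧` for `E` itself at `3 ∥ N` over every
strict odd Heegner datum, frame `(ι', Ω_K, Ω_p, L)` and the other prime `𝔭bar ∋ 3`. Road: Howard 2004a Thm. B port
at the Tate prime `3` (PROOF-BDP §38.8 ∕ §48, image row re-fed by (i′)–(iv′) of the card, print anchor MZ26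
Thm. 3.15 + §1 above) ∘ (ε3b)@3 ∘ (ε3c)@3. OPEN. -/
def CornerRatUpperDivisibilityAtThree : Prop :=
  ∀ (W : WeierstrassCurve ℚ) [W.IsElliptic] [W.IsGloballyMinimal],
    ClassX11b W 3 → ¬ Surj W 3 →
    ∀ (N : ℕ) [NeZero N] (K : Type) [Field K] [NumberField K] (Dt : ModularParametrizationData W N)
    (H : HeegnerDatum N (NumberField.discr K)) (ι : K →+* ℂ) (P : (W.baseChange K).toAffine.Point),
    W.conductorNorm ℤ = N → IsImaginaryQuadratic K →
    Odd (NumberField.discr K) → SatisfiesHeegnerHypothesis N K →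
    (W.quadraticTwist (NumberField.discr K : ℚ)).entireLFunction 1 ≠ 0 →
    WeierstrassCurve.Affine.Point.map ι.toRatAlgHom P = heegnerPointComplex Dt H →
    ¬ (3 : ℤ) ∣ Dt.c → ¬ IsOfFinAddOrder P →
    ∀ (κ : ZpExtension K 3), κ.IsAnticyclotomic →
      ∀ (γ : Field.absoluteGaloisGroup K) [Fact (κ.IsTopGenerator γ)]
        (𝔭 : HeightOneSpectrum (𝓞 K)), ((3 : ℕ) : 𝓞 K) ∈ 𝔭.asIdeal →
        𝔭.asIdeal.ramificationIdx (𝓞 ℚ) = 1 → 𝔭.asIdeal.inertiaDeg (𝓞 ℚ) = 1 →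
        ∀ (f : CuspForm (CongruenceSubgroup.Gamma0 N) 2), IsNewformOf W f →
          ∀ (ι' : PadicAlgCl 3 ≃+* ℂ), InducesPrime ι' 𝔭 →
            ∀ (ΩK : ℂ) (Ωp : (unrIntegers 3)ˣ) (L : UnrSeries 3), ΩK ≠ 0 →
              IsBDPLFunction ι' 𝔭 κ γ f ΩK ((Ωp : unrIntegers 3) : ℂ_[3]) L →
                ∀ (𝔭bar : HeightOneSpectrum (𝓞 K)), ((3 : ℕ) : 𝓞 K) ∈ 𝔭bar.asIdeal → 𝔭bar ≠ 𝔭 →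
                  ∃ k : ℕ, C (((3 : ℕ) : unrIntegers 3) ^ k) * L ∈
                    (XAc.charIdeal (W.baseChange K) 3 κ 𝔭bar ∅ γ).map (PowerSeries.map (toUnr 3))

/-- **Howard-currency intermediate (what MZ26 Thm. 3.15 literally outputs), typed on the corner at `3 ∥ N` in the
SHAPE of the tree's `MastellaZerman2026.cor46_howardDivisibility_of_scalarImage` with its two non-corner binders
(`¬ p ∣ N`, good ordinary) replaced by the corner's (`3 ∥ N` via `ClassX11b`, Heegner for `N = N_E` so `3` splits in
`K`)**: `char_Λ(X_{Λ-tors}) ∣ I(ℋ_∞)²` for every `Λ`-adic Selmer datum, Heegner family and Selmer-dual datum.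
(Supply of the Heegner family at `3 ∣ N` is the bdp lane's (ε3a) construction row, BD96 (7) ∕ `Castella2024`.) OPEN. -/
def CornerHowardDivisibilityAtThree : Prop :=
  ∀ (N : ℕ) [NeZero N] (W : WeierstrassCurve ℚ) [W.IsElliptic] [W.IsGloballyMinimal]
    (K : Type) [Field K] [NumberField K] (κ : ZpExtension K 3)
    (γ : Field.absoluteGaloisGroup K) (jbar : AlgebraicClosure K →+* ℂ),
    ClassX11b W 3 → ¬ Surj W 3 → W.conductorNorm ℤ = N → IsImaginaryQuadratic K →
    Odd (NumberField.discr K) → SatisfiesHeegnerHypothesis N K →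
    κ.IsAnticyclotomic → κ.IsTopGenerator γ →
    ∀ (D : (W.baseChange K).LambdaAdicSelmerData κ γ) (F : HeegnerFamily N W K κ jbar)
      (X : (W.baseChange K).SelmerDualData κ γ),
      Module.charIdeal (IwasawaAlgebra 3) (Submodule.torsion (IwasawaAlgebra 3) X.X) ∣
        heegnerCharIdeal D F ^ 2

/-! ### §3. Shape of the road to the crux conjunct (implications typed, NOT claimed) -/

/-- **The read-at-`𝟙` brick**: UB₃ on the corner, with `μ = 0` laundering of the `3^k` (`Λ` a UFD, `3` prime in
`Λ`, `μ(f_ac) = 0`) and Cas18 Thm. 3.2 at `p ∥ N` (`L(𝟙) = (1 − a₃3⁻¹)²·log_ω(P)²` up to a unit), gives the «⊇» half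
at `𝟙` on EVERY corner curve — `Theorems.CornerAtThreeCoStepL` (= `∀ W, Three.CornerCoStepLAt W`), which the
co-chain files turn into conjunct (U) `Three.CornerUpperAt W` (`cornerUpperAt_of_cornerCoStepLAt_of_facts`). -/
def CornerCoStepLOfUB : Prop :=
  CornerRatUpperDivisibilityAtThree → Theorems.CornerAtThreeCoStepL

/-- Bookkeeping (proved): the conjunction "UB₃ on the corner ∧ the read-at-𝟙 brick" yields the class-wide «⊇» half. -/
theorem cornerAtThreeCoStepL_of (hUB : CornerRatUpperDivisibilityAtThree) (hread : CornerCoStepLOfUB) :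
    Theorems.CornerAtThreeCoStepL :=
  hread hUB

end Summit.BirchSwinnertonDyer.BirchSwinnertonDyer.Cruxes.CornerAtThreeW.NormaliserImageHoward

end
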